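import Mathlib
import Summits.ValiantsHypothesis.ValiantsHypothesis.Theorems.LacunarySymmetroidMatrixDescartesGramDual
import Summits.ValiantsHypothesis.ValiantsHypothesis.Theorems.LacunarySymmetroidMatrixDescartesGramDualSigned

/-!
# `MatrixDescartes` (stmt-ValiantsHypothesis-18050) — Gram duality, part 7: the EFFECTIVE-SIZE REDUCTION
# (a pencil with a non-degenerate letter has the positive zeros of a pencil whose size is the rank of any
# factorisation `UᵀB⁻¹U = AᵀSA` of its Gram matrix — same exponents, same signs)

HONEST FRAMING.  Cell `pub-symmetroid`, seat `val-sym-mdr-p2` (gen 19); helper file `--supports` the crux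
`Theses.LacunarySymmetroid.MatrixDescartes` (OPEN), NO closure claim; companion of `…GramDualSigned` (signed Gram
duality: `X^eB + U diag(σX^δ) Uᵀ` has the positive zeros of `diag(σ⁻¹X^{E−δ}) + X^{E−e}·UᵀB⁻¹U`).  A structure
theorem; nothing here bears on the crux in its window, `stub_twoSided`, `DoorA26` / `DoorA34`, registers, or
`VP ≠ VNP`.

**THEOREM (`posRoots_base_eq_posRoots_reduced`, EFFECTIVE-SIZE REDUCTION).**  `B` real `ι × ι` with `det B ≠ 0`,
`U : ι × ρ` real, signs `σⱼ ≠ 0`, exponents `e, δⱼ`.  If the `B⁻¹`-Gram matrix of the columns factors as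

  `UᵀB⁻¹U = Aᵀ S A`   with `S : r × r` real, `det S ≠ 0`, `A : r × ρ` real (ANY `r`),

then the pencil `X^e B + U diag(σX^δ) Uᵀ` (size `card ι`) and the REDUCED pencil `X^e S⁻¹ + A diag(σX^δ) Aᵀ`
(size `card r`, the SAME exponents and signs, columns = the columns of `A`) have the same positive zeros of their
determinants (`card_posRoots_base_eq_card_posRoots_reduced`).  The smallest admissible `r` is `rank(UᵀB⁻¹U)`
(spectral factorisation keeping the non-zero eigenvalues; `≤ min(card ι, card ρ)`): the EFFECTIVE SIZE of a word is
the rank of its Gram matrix — the dimension of the column span MINUS the dimension of its `B⁻¹`-radical.  Columns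
in `B⁻¹`-isotropic directions `B⁻¹`-orthogonal to the whole span are invisible to `Z₊`; for `B` definite the
effective size is `dim span{uⱼ}`.  (Dualising twice: `X^{Er}·∏σ·X^{Σδ}·det 𝔻 = det S·X^{ER+(E−e)r}·det 𝕎`,
`reduced_identity`, by Sylvester `det(1+AB) = det(1+BA)` on the dual side.)

[folklore] (Sylvester's determinant identity; the lacunary-pencil reading is this seat's.)  Axioms `propext`,
`Classical.choice`, `Quot.sound`.
-/

-- layout Summits/ValiantsHypothesis/ValiantsHypothesis forces the duplicated namespace component
set_option linter.dupNamespace false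

namespace Summit.ValiantsHypothesis.ValiantsHypothesis.Theorems.LacunarySymmetroidMatrixDescartes

open Polynomial Matrix Finset
open scoped BigOperators

namespace GramDual

variable {ι ρ τ : Type*} [Fintype ι] [DecidableEq ι] [Fintype ρ] [DecidableEq ρ] [Fintype τ] [DecidableEq τ]

/-- the signed column part `U · diag(σⱼ X^{δⱼ}) · Uᵀ` (file-local notation, as in `…GramDualSigned`) -/
local notation3 (prettyPrint := false) "𝕊[" U ", " σ ", " δ "]" =>
  ((U : Matrix _ _ ℝ).map Polynomial.C
      * Matrix.diagonal (fun j => Polynomial.C ((σ : _ → ℝ) j) * (Polynomial.X : Polynomial ℝ) ^ (δ j : ℕ))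
      * ((U : Matrix _ _ ℝ).map Polynomial.C)ᵀ)

/-- the signed primal word (file-local notation, as in `…GramDualSigned`) -/
local notation3 (prettyPrint := false) "𝔽ₛ[" e ", " B ", " U ", " σ ", " δ "]" =>
  (((Polynomial.X : Polynomial ℝ) ^ (e : ℕ)) • (B : Matrix _ _ ℝ).map Polynomial.C + 𝕊[U, σ, δ])

/-- the signed dual word with an explicit Gram letter `C` (file-local notation) -/
local notation3 (prettyPrint := false) "𝔻c[" E ", " e ", " C ", " σ ", " δ "]" =>
  (Matrix.diagonal (fun j => Polynomial.C (((σ : _ → ℝ) j)⁻¹) * (Polynomial.X : Polynomial ℝ) ^ ((E : ℕ) - δ j))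
    + ((Polynomial.X : Polynomial ℝ) ^ ((E : ℕ) - (e : ℕ))) • (C : Matrix _ _ ℝ).map Polynomial.C)

/-! ## §1  Dualising the dual: pointwise identity -/

/-- **Pointwise reduction identity** (`x ≠ 0`, `σⱼ ≠ 0`, `det S ≠ 0`, `e, δⱼ ≤ E`):
`(x^E)^r · (∏σ·x^{Σδ}) · det(diag(σ⁻¹x^{E−δ}) + x^{E−e}AᵀSA) = det S · (x^E)^R · x^{(E−e)r} · det(x^eS⁻¹ + A diag(σx^δ) Aᵀ)`.
[folklore] -/
theorem reduced_pointwise (S : Matrix τ τ ℝ) (hS : IsUnit S.det) (A : Matrix τ ρ ℝ) (σ : ρ → ℝ)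
    (hσ : ∀ j, σ j ≠ 0) (e E : ℕ) (δ : ρ → ℕ) (he : e ≤ E) (hδ : ∀ j, δ j ≤ E) {x : ℝ} (hx : x ≠ 0) :
    (x ^ E) ^ Fintype.card τ * ((∏ j, σ j) * x ^ (∑ j, δ j)) *
        (Matrix.diagonal (fun j => (σ j)⁻¹ * x ^ (E - δ j)) + x ^ (E - e) • (Aᵀ * S * A)).det
      = S.det * (x ^ E) ^ Fintype.card ρ * (x ^ (E - e)) ^ Fintype.card τ *
        (x ^ e • S⁻¹ + A * Matrix.diagonal (fun j => σ j * x ^ δ j) * Aᵀ).det := by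
  set D : Matrix ρ ρ ℝ := Matrix.diagonal (fun j => σ j * x ^ δ j) with hD
  set Λ : Matrix ρ ρ ℝ := Matrix.diagonal (fun j => (σ j)⁻¹ * x ^ (E - δ j)) with hΛ
  set y : ℝ := x ^ (E - e) with hy
  have hΛD : Λ * D = x ^ E • (1 : Matrix ρ ρ ℝ) := by
    rw [hΛ, hD, Matrix.diagonal_mul_diagonal, ← Matrix.diagonal_one, ← Matrix.diagonal_smul]
    congr 1
    funext j
    rw [Pi.smul_apply, smul_eq_mul, mul_one, mul_mul_mul_comm, inv_mul_cancel₀ (hσ j), one_mul, ← pow_add,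
      Nat.sub_add_cancel (hδ j)]
  have hd : D.det = (∏ j, σ j) * x ^ (∑ j, δ j) := by
    rw [hD, Matrix.det_diagonal, Finset.prod_mul_distrib, Finset.prod_pow_eq_pow_sum]
  -- (Λ + yC) D = x^E 1 + (y AᵀS)(A D)
  have h1 : (Λ + y • (Aᵀ * S * A)) * D = x ^ E • (1 : Matrix ρ ρ ℝ) + (y • (Aᵀ * S)) * (A * D) := by
    rw [Matrix.add_mul, hΛD, Matrix.smul_mul, Matrix.smul_mul]
    simp only [Matrix.mul_assoc]
  -- Sylvester on the dual side
  have h2 : (x ^ E) ^ Fintype.card τ * (x ^ E • (1 : Matrix ρ ρ ℝ) + (y • (Aᵀ * S)) * (A * D)).det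
      = (x ^ E) ^ Fintype.card ρ * (x ^ E • (1 : Matrix τ τ ℝ) + (A * D) * (y • (Aᵀ * S))).det :=
    sylvester_scaled (y • (Aᵀ * S)) (A * D) (pow_ne_zero _ hx)
  -- x^E 1 + (A D)(y AᵀS) = (y • (x^e S⁻¹ + A D Aᵀ)) * S
  have h3 : x ^ E • (1 : Matrix τ τ ℝ) + (A * D) * (y • (Aᵀ * S))
      = (y • (x ^ e • S⁻¹ + A * D * Aᵀ)) * S := by
    rw [smul_add, smul_smul, hy, ← pow_add, Nat.sub_add_cancel he, Matrix.add_mul, Matrix.smul_mul,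
      Matrix.nonsing_inv_mul _ hS, Matrix.smul_mul, Matrix.mul_smul]
    simp only [Matrix.mul_assoc]
  have h4 : ((y • (x ^ e • S⁻¹ + A * D * Aᵀ)) * S).det
      = y ^ Fintype.card τ * (x ^ e • S⁻¹ + A * D * Aᵀ).det * S.det := by
    rw [Matrix.det_mul, Matrix.det_smul]
  -- assemble
  have h5 : (x ^ E) ^ Fintype.card τ * ((Λ + y • (Aᵀ * S * A)).det * D.det)
      = (x ^ E) ^ Fintype.card ρ * (y ^ Fintype.card τ * (x ^ e • S⁻¹ + A * D * Aᵀ).det * S.det) := by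
    rw [← Matrix.det_mul, h1, h2, h3, h4]
  rw [hd] at h5
  linear_combination h5

/-! ## §2  The reduction in `ℝ[X]` -/

/-- Evaluating the dual word with an explicit Gram letter. -/
theorem eval_dualC (C : Matrix ρ ρ ℝ) (σ : ρ → ℝ) (E e : ℕ) (δ : ρ → ℕ) (x : ℝ) :
    (Polynomial.evalRingHom x).mapMatrix (𝔻c[E, e, C, σ, δ])
      = Matrix.diagonal (fun j => (σ j)⁻¹ * x ^ (E - δ j)) + x ^ (E - e) • C := by
  ext i k
  simp only [RingHom.mapMatrix_apply, Matrix.map_apply, Matrix.add_apply, Matrix.smul_apply, smul_eq_mul,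
    Polynomial.coe_evalRingHom, Polynomial.eval_add, Polynomial.eval_mul, Polynomial.eval_pow,
    Polynomial.eval_X, Polynomial.eval_C, Matrix.diagonal_apply, apply_ite (Polynomial.eval x),
    Polynomial.eval_zero]

/-- `det` of the dual word with an explicit Gram letter, evaluated. -/
theorem eval_det_dualC (C : Matrix ρ ρ ℝ) (σ : ρ → ℝ) (E e : ℕ) (δ : ρ → ℕ) (x : ℝ) :
    (Matrix.det (𝔻c[E, e, C, σ, δ])).eval x
      = (Matrix.diagonal (fun j => (σ j)⁻¹ * x ^ (E - δ j)) + x ^ (E - e) • C).det := by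
  have h := RingHom.map_det (Polynomial.evalRingHom x) (𝔻c[E, e, C, σ, δ])
  rw [Polynomial.coe_evalRingHom] at h
  rw [h, eval_dualC]

/-- **Reduction identity in `ℝ[X]`**:
`X^{E·r}·C(∏σ)·X^{Σδ}·det 𝔻c[E,e,AᵀSA] = C(det S)·X^{E·R}·X^{(E−e)·r}·det(X^eS⁻¹ + A diag(σX^δ) Aᵀ)`. [folklore] -/
theorem reduced_identity (S : Matrix τ τ ℝ) (hS : IsUnit S.det) (A : Matrix τ ρ ℝ) (σ : ρ → ℝ)
    (hσ : ∀ j, σ j ≠ 0) (e E : ℕ) (δ : ρ → ℕ) (he : e ≤ E) (hδ : ∀ j, δ j ≤ E) :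
    ((Polynomial.X : Polynomial ℝ) ^ E) ^ Fintype.card τ
        * (Polynomial.C (∏ j, σ j) * (Polynomial.X : Polynomial ℝ) ^ (∑ j, δ j))
        * Matrix.det (𝔻c[E, e, (Aᵀ * S * A), σ, δ])
      = Polynomial.C S.det * ((Polynomial.X : Polynomial ℝ) ^ E) ^ Fintype.card ρ
        * ((Polynomial.X : Polynomial ℝ) ^ (E - e)) ^ Fintype.card τ
        * Matrix.det (𝔽ₛ[e, S⁻¹, A, σ, δ]) := by
  apply Polynomial.eq_of_infinite_eval_eq
  refine Set.Infinite.mono (s := {x : ℝ | x ≠ 0}) (fun x hx => ?_)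
    ((Set.finite_singleton (0 : ℝ)).infinite_compl.mono fun x hx => by
      simpa [Set.mem_compl_iff, Set.mem_singleton_iff] using hx)
  simp only [Set.mem_setOf_eq] at hx ⊢
  simp only [Polynomial.eval_mul, Polynomial.eval_pow, Polynomial.eval_X, Polynomial.eval_C]
  rw [eval_det_dualC, eval_det_base]
  exact reduced_pointwise S hS A σ hσ e E δ he hδ hx

/-- The dual determinant and the reduced determinant vanish identically together. [folklore] -/
theorem det_dualC_eq_zero_iff (S : Matrix τ τ ℝ) (hS : IsUnit S.det) (A : Matrix τ ρ ℝ) (σ : ρ → ℝ)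
    (hσ : ∀ j, σ j ≠ 0) (e E : ℕ) (δ : ρ → ℕ) (he : e ≤ E) (hδ : ∀ j, δ j ≤ E) :
    Matrix.det (𝔻c[E, e, (Aᵀ * S * A), σ, δ]) = 0 ↔ Matrix.det (𝔽ₛ[e, S⁻¹, A, σ, δ]) = 0 := by
  have h := reduced_identity S hS A σ hσ e E δ he hδ
  have hX : ∀ n : ℕ, (Polynomial.X : Polynomial ℝ) ^ n ≠ 0 := fun n => pow_ne_zero _ Polynomial.X_ne_zero
  have hXX : ∀ n k : ℕ, ((Polynomial.X : Polynomial ℝ) ^ n) ^ k ≠ 0 := fun n k => pow_ne_zero _ (hX n)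
  have hσC : Polynomial.C (∏ j, σ j) ≠ 0 := by
    rw [Ne, Polynomial.C_eq_zero]; exact Finset.prod_ne_zero_iff.2 fun j _ => hσ j
  have hSC : Polynomial.C S.det ≠ 0 := by rw [Ne, Polynomial.C_eq_zero]; exact hS.ne_zero
  constructor
  · intro h0
    rw [h0, mul_zero] at h
    rcases mul_eq_zero.1 h.symm with h1 | h1
    · rcases mul_eq_zero.1 h1 with h2 | h2
      · rcases mul_eq_zero.1 h2 with h3 | h3
        · exact absurd h3 hSC
        · exact absurd h3 (hXX _ _)
      · exact absurd h2 (hXX _ _)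
    · exact h1
  · intro h0
    rw [h0, mul_zero] at h
    rcases mul_eq_zero.1 h with h1 | h1
    · rcases mul_eq_zero.1 h1 with h2 | h2
      · exact absurd h2 (hXX _ _)
      · rcases mul_eq_zero.1 h2 with h3 | h3
        · exact absurd h3 hσC
        · exact absurd h3 (hX _)
    · exact h1

/-- Same vanishing at every non-zero scale. [folklore] -/
theorem eval_det_dualC_eq_zero_iff (S : Matrix τ τ ℝ) (hS : IsUnit S.det) (A : Matrix τ ρ ℝ) (σ : ρ → ℝ)
    (hσ : ∀ j, σ j ≠ 0) (e E : ℕ) (δ : ρ → ℕ) (he : e ≤ E) (hδ : ∀ j, δ j ≤ E) {x : ℝ} (hx : x ≠ 0) :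
    (Matrix.det (𝔻c[E, e, (Aᵀ * S * A), σ, δ])).eval x = 0
      ↔ (Matrix.det (𝔽ₛ[e, S⁻¹, A, σ, δ])).eval x = 0 := by
  have h := reduced_pointwise S hS A σ hσ e E δ he hδ hx
  rw [eval_det_dualC, eval_det_base]
  have h1 : (x ^ E) ^ Fintype.card τ * ((∏ j, σ j) * x ^ (∑ j, δ j)) ≠ 0 :=
    mul_ne_zero (pow_ne_zero _ (pow_ne_zero _ hx))
      (mul_ne_zero (Finset.prod_ne_zero_iff.2 fun j _ => hσ j) (pow_ne_zero _ hx))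
  have h2 : S.det * (x ^ E) ^ Fintype.card ρ * (x ^ (E - e)) ^ Fintype.card τ ≠ 0 :=
    mul_ne_zero (mul_ne_zero hS.ne_zero (pow_ne_zero _ (pow_ne_zero _ hx))) (pow_ne_zero _ (pow_ne_zero _ hx))
  constructor
  · intro h0
    rw [h0, mul_zero] at h
    exact (mul_eq_zero.1 h.symm).resolve_left h2
  · intro h0
    rw [h0, mul_zero] at h
    exact (mul_eq_zero.1 h).resolve_left h1

/-- Positive zeros of the dual word with Gram letter `AᵀSA` = positive zeros of the reduced word. [folklore] -/
theorem posRoots_dualC_eq_posRoots_reduced (S : Matrix τ τ ℝ) (hS : IsUnit S.det) (A : Matrix τ ρ ℝ) (σ : ρ → ℝ)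
    (hσ : ∀ j, σ j ≠ 0) (e E : ℕ) (δ : ρ → ℕ) (he : e ≤ E) (hδ : ∀ j, δ j ≤ E) :
    (Matrix.det (𝔻c[E, e, (Aᵀ * S * A), σ, δ])).roots.toFinset.filter (fun t => 0 < t)
      = (Matrix.det (𝔽ₛ[e, S⁻¹, A, σ, δ])).roots.toFinset.filter (fun t => 0 < t) := by
  ext t
  simp only [Finset.mem_filter, Multiset.mem_toFinset, Polynomial.mem_roots', Polynomial.IsRoot.def]
  constructor
  · rintro ⟨⟨hne, hev⟩, ht⟩
    exact ⟨⟨fun h0 => hne ((det_dualC_eq_zero_iff S hS A σ hσ e E δ he hδ).2 h0),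
      (eval_det_dualC_eq_zero_iff S hS A σ hσ e E δ he hδ ht.ne').1 hev⟩, ht⟩
  · rintro ⟨⟨hne, hev⟩, ht⟩
    exact ⟨⟨fun h0 => hne ((det_dualC_eq_zero_iff S hS A σ hσ e E δ he hδ).1 h0),
      (eval_det_dualC_eq_zero_iff S hS A σ hσ e E δ he hδ ht.ne').2 hev⟩, ht⟩

/-! ## §3  The effective-size reduction -/

/-- **EFFECTIVE-SIZE REDUCTION.**  `det B ≠ 0`, `σⱼ ≠ 0`; if `UᵀB⁻¹U = AᵀSA` with `det S ≠ 0` (`S : r × r`,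
`A : r × ρ`, any index type `r`), then the pencils `X^eB + U diag(σX^δ) Uᵀ` (size `card ι`) and
`X^eS⁻¹ + A diag(σX^δ) Aᵀ` (size `card r`) have the same positive zeros of their determinants. [folklore] -/
theorem posRoots_base_eq_posRoots_reduced (B : Matrix ι ι ℝ) (hB : IsUnit B.det) (U : Matrix ι ρ ℝ)
    (σ : ρ → ℝ) (hσ : ∀ j, σ j ≠ 0) (e : ℕ) (δ : ρ → ℕ) (S : Matrix τ τ ℝ) (hS : IsUnit S.det)
    (A : Matrix τ ρ ℝ) (hfac : Uᵀ * B⁻¹ * U = Aᵀ * S * A) :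
    (Matrix.det (𝔽ₛ[e, B, U, σ, δ])).roots.toFinset.filter (fun t => 0 < t)
      = (Matrix.det (𝔽ₛ[e, S⁻¹, A, σ, δ])).roots.toFinset.filter (fun t => 0 < t) := by
  classical
  obtain ⟨E, he, hδ⟩ := exists_bound e δ
  rw [posRoots_base_eq B hB U σ hσ e E δ he hδ, hfac]
  exact posRoots_dualC_eq_posRoots_reduced S hS A σ hσ e E δ he hδ

/-- **EFFECTIVE SIZE, counted**: `Z₊(X^eB + U diag(σX^δ) Uᵀ) = Z₊(X^eS⁻¹ + A diag(σX^δ) Aᵀ)` whenever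
`UᵀB⁻¹U = AᵀSA`, `det S ≠ 0` — the positive-zero count of a word only sees a pencil of size `rank` of (any
non-degenerate factorisation of) its Gram matrix. [folklore] -/
theorem card_posRoots_base_eq_card_posRoots_reduced (B : Matrix ι ι ℝ) (hB : IsUnit B.det) (U : Matrix ι ρ ℝ)
    (σ : ρ → ℝ) (hσ : ∀ j, σ j ≠ 0) (e : ℕ) (δ : ρ → ℕ) (S : Matrix τ τ ℝ) (hS : IsUnit S.det)
    (A : Matrix τ ρ ℝ) (hfac : Uᵀ * B⁻¹ * U = Aᵀ * S * A) :
    ((Matrix.det (𝔽ₛ[e, B, U, σ, δ])).roots.toFinset.filter (fun t => 0 < t)).card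
      = ((Matrix.det (𝔽ₛ[e, S⁻¹, A, σ, δ])).roots.toFinset.filter (fun t => 0 < t)).card := by
  rw [posRoots_base_eq_posRoots_reduced B hB U σ hσ e δ S hS A hfac]

end GramDual

end Summit.ValiantsHypothesis.ValiantsHypothesis.Theorems.LacunarySymmetroidMatrixDescartes
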